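import Summits.BirchSwinnertonDyer.Rank1Residual.Additive.DefectCountFiniteLevelOfFacts
import Summits.BirchSwinnertonDyer.Rank1Residual.Additive.SignedSelmerLevelBridgeLocal
import HarnessLib

/-!
# THE COUNT (C) WITH A RECEPTACLE AT `v₀`: **`[A₀ : S₀] · p^{m−t−ν} = #(p^t·C) · ∏_{ℓ ∈ T} [𝓣_ℓ : 𝓚_ℓ]`**
# for `𝓖 = 𝓣[v₀ ↦ 𝓣_{v₀} ⊓ G]`, ANY local group `G` containing `loc_{v₀}(Ψ_m⁻¹A₀)` and detecting the
# signed condition — files 69 (the count at finite level) and 84 (the bridge with a receptacle)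
# COMPOSED; the fix of file 77's literal `hC` (cell `b2b-bsdres`, CLASS-CLOSURE lane, class O10 —
# x1b GEN 41, class lead; file 99 of the series)

HONEST FRAMING (cell `b2b-bsdres`, run/shared/lean/b2b/bsd-rank1-residual/, verbatim in every
file): the goal of the cell is to DELETE the COMBINATION-SHAPED residual classes of the
Birch–Swinnerton-Dyer formula for ALL analytic-rank `≤ 1` elliptic curves over `ℚ` — "full BSD
formula for every rank `≤ 1` curve in class `C`" assembled STRICTLY from published theorems — so
that the rank-`≤ 1` remainder becomes exactly the CONSTRUCTION-SHAPED classes, which are TYPED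
(missing-input `Prop`s), NOT attempted. This is not "finishing BSD". CLASS-CLOSURE lane: prove
what is provable now; shrink each hard class to its core with data; no claim beyond stated classes;
research routes on CONSTRUCTION-SHAPED X12 / O10; census / instrument output = EVIDENCE / conjecture
items, NEVER a Literature fact; `RESIDUAL-MAP.md` marks change only by signed lines. THIS FILE:
TOOL THEOREMS ONLY — no definition, no named Literature fact, no Summits-side fact `def … : Prop`,
no `sorry`, axioms standard; CONDITIONAL (hypotheses) on a Poitou–Tate family injective at the real
places (the property list of the tree's named fact `poitouTate_selmerStructure_duality_real`), on
Tate's local Euler characteristic (named fact `localEulerPoincareCharacteristic`), on the receptacle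
data at `v₀` (`hLG`, `hG`, `𝓣_{v₀} ⊓ G = p^t·C`, `C ⊔ 𝓚_{v₀} = ⊤`), and on the rank-one / `Ш` /
local-point inputs; nothing is booked; no label / mark / count / sub-cell moves; (C1_η), (C2_η-GZ),
(C3_η) stay typed as filed (cc-typer-6's pen); O10 stays OPEN / CONSTRUCTION-SHAPED; nothing about
`BSD(W, p)` of any pair is claimed.

## What (x1b GEN 39 note §3 (iv): the design flaw of file 77's `hC` and its fix)

File 77 ran the count with the local group `𝓣_{v₀} ⊓ L`, `L = loc_{v₀}(Ψ_m⁻¹A₀)`, and the hypothesis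
`hC : 𝓣_{v₀} ⊓ L = p^t·C`, `C ⊔ 𝓚_{v₀} = ⊤`, `t + ν ≤ m` — which silently forces the GLOBAL bound
`#L ≥ p^ν` (half of the conclusion). File 84 proved the bridge `[H¹_{𝓣[v₀ ↦ 𝓣_{v₀} ⊓ G]} :
H¹_{𝓚[v₀ ↦ 0]}] = [A₀ : S₀]` for ANY receptacle `G ≤ H¹(K_{v₀}, E[p^m])` with (a) `hLG`: `Ψ_m c ∈ A₀ ⟹
loc_{v₀} c ∈ G` and (b) `hG`: `Ψ_m c ∈ h_0⁻¹(Sel_∞)`, `loc_{v₀} c ∈ G ⟹ Ψ_m c` signed at `E`.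

**`relIndex_strictSignedSelmerLayer_localPreimage_mul_prime_pow_eq_of_receptacle`.** File 69
(`relIndex_mul_prime_pow_eq_of_rankOne_of_facts`) for `𝓖 = 𝓣[v₀ ↦ 𝓣_{v₀} ⊓ G]` (`= 𝓚` off
`T ∪ {v₀}`, `⊇ 𝓚` on `T`, `= p^t·C` at `v₀` by `hC : 𝓣_{v₀} ⊓ G = p^t·C`) composed with file 84:
**`[A₀ : S₀] · p^{m−t−ν} = #(p^t·C) · ∏_{ℓ ∈ T} [𝓣_ℓ : 𝓚_ℓ]`** under (exactly) file 77's hypotheses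
with `hC` replaced by the receptacle data `G`, `hLG`, `hG`, `𝓣_{v₀} ⊓ G = p^t·C`. Intended instance
(B3, x1b GEN 39–41, files 79–98): `C = Σ_m` the level-`m` minus line at `v₀` (cyclic of order `p^m`,
`Σ_m ⊔ 𝓚_{v₀} = ⊤`), `G = p^{ν+e}·Σ_m`, `t = ν + e`, where (a) is `#L ≤ p^{m−ν−e}` inside the cyclic
`Σ_m` and (b) is file 85. CONDITIONAL on the listed hypotheses; nothing booked.

References: [GreenbergLNM1716] §3–§4; [Kobayashi2003] Def. 2.1, Thm. 6.2, §9; [MilneADT2006] I §2–§6;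
[Howard2004HeegnerKolyvagin] Thm. 2.1.11.
-/

noncomputable section

open scoped Classical

open CategoryTheory Field Function NumberField IsDedekindDomain WeierstrassCurve
open Literature.NumberTheory.EllipticCurves
open Literature.NumberTheory.GaloisRepresentations
open Literature.NumberTheory.GaloisRepresentations.DiscreteGaloisModule (SelmerStructure)
open Literature.NumberTheory.GaloisCohomology
open Literature.NumberTheory.EllipticCurves.Kobayashi2003
open Summit.BirchSwinnertonDyer.Rank1Residual.X11b.Levels
open Summit.BirchSwinnertonDyer.Rank1Residual.X11b
open Summit.BirchSwinnertonDyer.Rank1Residual.Additive.DefectCountFiniteLevel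
open scoped ContRepresentation

namespace Summit.BirchSwinnertonDyer.Rank1Residual.Additive.LevelBridge

variable {K : Type} [Field K] [NumberField K] (W : WeierstrassCurve K) [W.IsElliptic]

/-- **THE COUNT (C) FOR `A₀ = Sel^{loc,∞}`, `S₀ = Sel^{−,str}(E/K_0)` WITH A RECEPTACLE `G` AT `v₀`**:
`[A₀ : S₀] · p^{m−t−ν} = #(p^t·C) · ∏_{ℓ ∈ T} [𝓣_ℓ : 𝓚_ℓ]` — file 69
(`relIndex_mul_prime_pow_eq_of_rankOne_of_facts`) for the Selmer structure
`𝓖 = 𝓣[v₀ ↦ 𝓣_{v₀} ⊓ G]` (`= 𝓚` off `T ∪ {v₀}` by `eq_kummerSelmerStructure_of_not_mem`,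
`⊇ 𝓚` on `T` by `kummerSelmerStructure_inr_le_comap_localTowerKer`, `= p^t·C` at `v₀` by `hC`)
composed with the receptacle bridge `[H¹_𝓖 : H¹_{𝓚[v₀ ↦ 0]}] = [A₀ : S₀]` (file 84
`relIndex_selmerGroup_update_eq_relIndex_strictSignedSelmerLayer_of_receptacle`, hypotheses `hLG`,
`hG`).  CONDITIONAL on the listed hypotheses (Poitou–Tate family at level `p^m`, Tate's local Euler
characteristic, the receptacle data, `p^m A₀ = 0`, (MW), (Ш), (Γ), (loc), (span), (kill)); nothing
booked. Universe: `K : Type`.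
[cite: GreenbergLNM1716, §4 (pp. 98–103)] [cite: Kobayashi2003, Def. 2.1 (p. 5), Thm. 9.3 (p. 26)]
[cite: MilneADT2006, Ch. I, Thm. 2.8, Lemma 3.3 and Thm. 4.10] -/
theorem relIndex_strictSignedSelmerLayer_localPreimage_mul_prime_pow_eq_of_receptacle {p m : ℕ} [hp : Fact p.Prime]
    (κ : ZpExtension K p) (hm : 1 ≤ m)
    (inv : LocalInvariants K (p ^ m)) (hperf : inv.IsPerfect) (hvan : inv.SumLocalTermEqZero)
    (hcomp : inv.SelmerComplement)
    (hreal : ∀ w : InfinitePlace K, w.IsReal → Injective (inv (Sum.inl w)))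
    (hEP : ∀ v : HeightOneSpectrum (𝓞 K), localEulerPoincareCharacteristic (v.adicCompletion K))
    (w₀ : HeightOneSpectrum (𝓞 K))
    (hOv : Nat.card (w₀.adicCompletionIntegers K ⧸
      Ideal.span {((p ^ m : ℕ) : w₀.adicCompletionIntegers K)}) = p ^ m)
    -- the model `E` of `K_{v₀}`
    (E : Type) [Field E] [Algebra K E] [Algebra (w₀.adicCompletion K) E]
    [IsScalarTower K (w₀.adicCompletion K) E] [Algebra E (w₀.adicCompletion K)]
    [IsScalarTower K E (w₀.adicCompletion K)]
    (hΓE : ∀ Q : W.geomPrimaryTorsion p, (∀ σ : absoluteGaloisGroup E,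
      GaloisRep.restrictField E (LocBridge.primaryGaloisModule W p) σ Q = Q) → Q = 0)
    -- the tower structure and the exceptional set
    (T : Finset (HeightOneSpectrum (𝓞 K))) (hw₀T : w₀ ∉ T)
    (𝓣 : SelmerStructure (W.torsionGaloisModule ((p ^ m : ℕ) : ℤ)))
    (h𝓣fin : ∀ v : HeightOneSpectrum (𝓞 K), 𝓣 (Sum.inr v) =
      (W.localTowerKer κ (v.adicCompletion K) 0).comap
        ((resH1Hom (Literature.NumberTheory.EllipticCurves.subgroupIncl (localSubgroup (κ.layerSubgroup 0) (v.adicCompletion K)))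
          (AddMonoidHom.id (localPoints W (v.adicCompletion K))) (fun _ _ ↦ rfl)).comp
          (galoisCohomology.map
            (W.torsionPointsMapIntertwining ((p ^ m : ℕ) : ℤ) (v.adicCompletion K)) 1)))
    (h𝓣inf : ∀ w : InfinitePlace K, 𝓣 (Sum.inl w) = W.kummerSelmerStructure ((p ^ m : ℕ) : ℤ) (Sum.inl w))
    (hT0 : ∀ v : HeightOneSpectrum (𝓞 K), v ∉ T → v ≠ w₀ →
      W.localTowerKerPrimary κ (v.adicCompletion K) 0 = ⊥)
    -- the receptacle `G` at `v₀`, the B3-shaped `𝓣_{v₀} ⊓ G = p^t·C`, and `p^m A₀ = 0`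
    (G : AddSubgroup (galoisCohomology
      ((W.torsionGaloisModule ((p ^ m : ℕ) : ℤ)).toLocal (Sum.inr w₀)) 1))
    (hLG : ∀ c : galoisCohomology (W.torsionGaloisModule ((p ^ m : ℕ) : ℤ)) 1,
      resH1Hom (Literature.NumberTheory.EllipticCurves.subgroupIncl (κ.layerSubgroup 0))
        (AddMonoidHom.id (geomPrimaryTorsion W p))
        (fun _ _ ↦ rfl) (galoisCohomology.map (primaryInclusion W p m) 1 c) ∈
        (W.selmerInfty κ ⊓ ⨅ σ : absoluteGaloisGroup K,
            (localKummerOverOfEmb W p κ.kerSubgroup (closureEmb (K := K) E)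
              (⨆ n, strictSignedLocalPoints κ E W (-1) n)).comap
              (W.conjH1 p κ.kerSubgroup σ)).comap (W.layerToInfty κ 0) →
      galoisCohomology.localization (W.torsionGaloisModule ((p ^ m : ℕ) : ℤ)) (Sum.inr w₀) 1 c ∈ G)
    (hG : ∀ c : galoisCohomology (W.torsionGaloisModule ((p ^ m : ℕ) : ℤ)) 1,
      resH1Hom (Literature.NumberTheory.EllipticCurves.subgroupIncl (κ.layerSubgroup 0))
        (AddMonoidHom.id (geomPrimaryTorsion W p))
        (fun _ _ ↦ rfl) (galoisCohomology.map (primaryInclusion W p m) 1 c) ∈ W.selmerInftyPreimage κ 0 →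
      galoisCohomology.localization (W.torsionGaloisModule ((p ^ m : ℕ) : ℤ)) (Sum.inr w₀) 1 c ∈ G →
      resH1Hom (Literature.NumberTheory.EllipticCurves.subgroupIncl (κ.layerSubgroup 0))
        (AddMonoidHom.id (geomPrimaryTorsion W p))
        (fun _ _ ↦ rfl) (galoisCohomology.map (primaryInclusion W p m) 1 c) ∈
        (⨅ σ : absoluteGaloisGroup K,
            (localKummerOverOfEmb W p κ.kerSubgroup (closureEmb (K := K) E)
              (⨆ n, strictSignedLocalPoints κ E W (-1) n)).comap
              (W.conjH1 p κ.kerSubgroup σ)).comap (W.layerToInfty κ 0))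
    (C : AddSubgroup (galoisCohomology
      ((W.torsionGaloisModule ((p ^ m : ℕ) : ℤ)).toLocal (Sum.inr w₀)) 1))
    {t ν eSha : ℕ}
    (hC : 𝓣 (Sum.inr w₀) ⊓ G = C.map (nsmulAddMonoidHom (p ^ t)))
    (hA₀ : ∀ z ∈ (W.selmerInfty κ ⊓ ⨅ σ : absoluteGaloisGroup K,
        (localKummerOverOfEmb W p κ.kerSubgroup (closureEmb (K := K) E)
          (⨆ n, strictSignedLocalPoints κ E W (-1) n)).comap
            (W.conjH1 p κ.kerSubgroup σ)).comap (W.layerToInfty κ 0), p ^ m • z = 0)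
    -- (MW)
    (hdiv : W.zsmul_geomPoints_surjective) (P : W.toAffine.Point)
    (hgen : ∀ Q : W.toAffine.Point, ∃ a : ℤ,
      Q - a • P ∈ (zsmulAddGroupHom ((p ^ m : ℕ) : ℤ) : W.toAffine.Point →+ _).range)
    (hord : ∀ a : ℤ, a • P ∈ (zsmulAddGroupHom ((p ^ m : ℕ) : ℤ) : W.toAffine.Point →+ _).range →
      ((p ^ m : ℕ) : ℤ) ∣ a)
    -- (Ш)
    (hSha : ∀ c ∈ W.sha, ((p ^ m : ℕ) : ℤ) • c = 0 → p ^ eSha • c = 0)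
    -- (Γ)
    (hΓ : ∀ Q : W.geomPrimaryTorsion p,
      (∀ σ : absoluteGaloisGroup K, X11b.LocBridge.primaryGaloisModule W p σ Q = Q) → Q = 0)
    -- (loc) at `v₀`
    [CharZero (Place.Completion (Sum.inr w₀ : Place K))]
    (htors : ∀ X : (W.baseChange (Place.Completion (Sum.inr w₀ : Place K))).toAffine.Point,
      p • X = 0 → X = 0)
    {Qv : (W.baseChange (Place.Completion (Sum.inr w₀ : Place K))).toAffine.Point}
    (hPQ : p ^ ν • Qv = Affine.Point.baseChange (W' := W) K (Place.Completion (Sum.inr w₀ : Place K)) P)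
    (hexact : ∀ Q' : (W.baseChange (Place.Completion (Sum.inr w₀ : Place K))).toAffine.Point,
      p ^ (ν + 1) • Q' ≠ Affine.Point.baseChange (W' := W) K (Place.Completion (Sum.inr w₀ : Place K)) P)
    -- (span) at `v₀`
    (hCL : C ⊔ W.kummerSelmerStructure ((p ^ m : ℕ) : ℤ) (Sum.inr w₀) = ⊤)
    -- (kill) at `ℓ ∈ T`
    (hkill : ∀ w ∈ T, ∀ x ∈ W.kummerSelmerStructure ((p ^ m : ℕ) : ℤ) (Sum.inr w),
      p ^ (m - t - ν) • x = 0)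
    (het : ν + eSha ≤ t) (htν : t + ν ≤ m) :
    (strictSignedSelmerLayer W κ E (-1) 0).relIndex
        ((W.selmerInfty κ ⊓ ⨅ σ : absoluteGaloisGroup K,
          (localKummerOverOfEmb W p κ.kerSubgroup (closureEmb (K := K) E)
            (⨆ n, strictSignedLocalPoints κ E W (-1) n)).comap
              (W.conjH1 p κ.kerSubgroup σ)).comap (W.layerToInfty κ 0)) * p ^ (m - t - ν) =
      Nat.card (C.map (nsmulAddMonoidHom (p ^ t))) *
        ∏ w ∈ T, (W.kummerSelmerStructure ((p ^ m : ℕ) : ℤ) (Sum.inr w)).relIndex (𝓣 (Sum.inr w)) := by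
  have hne : ∀ w ∈ T, (Sum.inr w : Place K) ≠ Sum.inr w₀ := fun w hw h ↦
    hw₀T (by rwa [Sum.inr_injective h] at hw)
  -- the three shape hypotheses of file 69 for `𝓖 = 𝓣[v₀ ↦ 𝓣_{v₀} ⊓ G]`
  have h𝓖v₀ : Function.update 𝓣 (Sum.inr w₀) (𝓣 (Sum.inr w₀) ⊓ G) (Sum.inr w₀) =
      C.map (nsmulAddMonoidHom (p ^ t)) := by
    rw [Function.update_self, hC]
  have h𝓖T : ∀ w ∈ T, W.kummerSelmerStructure ((p ^ m : ℕ) : ℤ) (Sum.inr w) ≤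
      Function.update 𝓣 (Sum.inr w₀) (𝓣 (Sum.inr w₀) ⊓ G) (Sum.inr w) := fun w hw ↦ by
    rw [Function.update_of_ne (hne w hw), h𝓣fin w]
    exact kummerSelmerStructure_inr_le_comap_localTowerKer W p κ m w
  have h𝓖off : ∀ v : Place K, v ≠ Sum.inr w₀ → (∀ w ∈ T, v ≠ Sum.inr w) →
      Function.update 𝓣 (Sum.inr w₀) (𝓣 (Sum.inr w₀) ⊓ G) v =
        W.kummerSelmerStructure ((p ^ m : ℕ) : ℤ) v := fun v hv hvT ↦ by
    rw [Function.update_of_ne hv]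
    refine eq_kummerSelmerStructure_of_not_mem W p κ m 𝓣 h𝓣fin h𝓣inf {u | u ∈ T ∨ u = w₀}
      (fun u hu ↦ hT0 u (fun h ↦ hu (Or.inl h)) (fun h ↦ hu (Or.inr h))) v fun u hu ↦ ?_
    rcases hu with hu | rfl
    · exact hvT u hu
    · exact hv
  -- file 69 for this `𝓖`
  have h69 := relIndex_mul_prime_pow_eq_of_rankOne_of_facts W hm inv hperf hvan hcomp hreal hEP w₀ hOv
    T hw₀T C (Function.update 𝓣 (Sum.inr w₀) (𝓣 (Sum.inr w₀) ⊓ G)) h𝓖v₀ h𝓖T h𝓖off hdiv P hgen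
    hord hSha hΓ htors hPQ hexact hCL hkill het htν
  -- file 84: the bridge with the receptacle `G`
  have h84 := relIndex_selmerGroup_update_eq_relIndex_strictSignedSelmerLayer_of_receptacle W p κ m w₀ E
    hdiv hΓE 𝓣 h𝓣fin h𝓣inf hA₀ G hLG hG
  rw [← h84]
  have hprod : ∏ w ∈ T, (W.kummerSelmerStructure ((p ^ m : ℕ) : ℤ) (Sum.inr w)).relIndex
        (Function.update 𝓣 (Sum.inr w₀) (𝓣 (Sum.inr w₀) ⊓ G) (Sum.inr w)) =
      ∏ w ∈ T, (W.kummerSelmerStructure ((p ^ m : ℕ) : ℤ) (Sum.inr w)).relIndex (𝓣 (Sum.inr w)) :=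
    Finset.prod_congr rfl fun w hw ↦ by rw [Function.update_of_ne (hne w hw)]
  rw [← hprod]
  exact h69

end Summit.BirchSwinnertonDyer.Rank1Residual.Additive.LevelBridge

end
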